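import Summits.NavierStokesRegularity.OSWSelfSimilar.SheetREvenPairUniqueness
import Summits.NavierStokesRegularity.OSWSelfSimilar.SheetROddClass
import HarnessLib

/-!
# SHEET-ℝ frame, EVEN ZERO-MASS class `E⁺₀` — dictionary layer 7: the EVEN ZERO-MASS classes of the pivot spaces `L²_w(ℝ)` / `L²_w(ℂ)`
# as closed subspaces, and the density lemma «an even zero-mass `g ∈ L²_w` orthogonal to every zero-mass even test is zero»

HONEST FRAMING (cell ns-blowup GROUP B / zone Z3, case Z3-SR-SPEC EVEN half; 1-D MODEL certificate frame (viscous gCLM/OSW sheet on the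
line); not Euler/NS; «violates: none — MODEL»).  Nothing here asserts that a profile exists.  Twin of `SheetROddClass` for DESIGN-Z3-SR-SPEC-EVEN
(D1)'s pivot class (even AND zero mass — the codimension-one direction `w⁻¹` is even but massive):

* `WevenZ hL := ker(1 − reflW) ⊓ ker(massW)`, `WcevenZ hL := {G | Re G, Im G ∈ WevenZ}` — closed submodules of `W L`, `Wc L` (`ℂ`-submodule via
  `reW_smul` / `imW_smul`), `completeSpace_WcevenZ`; `mem_WevenZ_iff_ae` (`g(−ξ) = g(ξ)` a.e. and `∫ g = 0`); `ofPair_mem_WcevenZ`, `toPair_mem_WevenZ`;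
* `ιEE_mem_WevenZ` — even energy-space profiles are even with zero mass: `ιEE p ∈ WevenZ`; `ofPair (ιpairE P) ∈ WcevenZ`;
* **`eq_zero_of_mem_WevenZ`** — if `g ∈ WevenZ` and `∫ w g v = 0` for every ZERO-MASS even test `(v, v₁)`, then `g = 0`: by the defect device
  `∫ w g φ = C·∫φ` for every even test; the even part of a smooth bump is an even test and the odd part pairs to zero against the a.e.-even
  `w·g`, so `w·g − C` annihilates `C_c^∞` (Mathlib `ae_eq_zero_of_integral_contDiff_smul_eq_zero`) ⇒ `g = C·w⁻¹` a.e. ⇒ zero mass and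
  `∫ w⁻¹ = π/L ≠ 0` force `C = 0`; `eq_zero_of_mem_WcevenZ` — complex version.
Two submodules (definitions); no named fact.  WHAT THIS IS NOT: not NS; no number of record moves.
-/

noncomputable section

namespace Summit.NavierStokesRegularity.OSWSelfSimilar
namespace SheetREvenClass

open _root_.MeasureTheory _root_.Set _root_.Filter _root_.Real SheetRWeakProfilePV SheetRWeakToStrong SheetREnergyClass SheetRWeightedMeasure
  SheetRLinearisedTests SheetREnergySpace SheetRTestSpace SheetREvenTests SheetREvenEnergySpace SheetREvenForms SheetREvenPairUniqueness
  SheetRComplexPivot SheetROddClass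
open scoped Topology ENNReal

variable {L : ℝ}

/-! ### §1 The even zero-mass class of `L²_w(ℝ)` -/

/-- **The even zero-mass class of `L²_w(ℝ)`**: `WevenZ = ker(1 − reflW) ⊓ ker(massW) = {g | g(−ξ) = g(ξ) a.e., ∫ g = 0}`. [folklore] -/
def WevenZ (hL : 0 < L) : Submodule ℝ (W L) :=
  LinearMap.ker ((ContinuousLinearMap.id ℝ (W L) - reflW L : W L →L[ℝ] W L) : W L →ₗ[ℝ] W L) ⊓
    LinearMap.ker ((massW hL : W L →L[ℝ] ℝ) : W L →ₗ[ℝ] ℝ)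

/-- Membership in the even zero-mass class: `reflW L g = g` and `∫ g = 0`. [folklore] -/
theorem mem_WevenZ_iff (hL : 0 < L) (g : W L) : g ∈ WevenZ hL ↔ reflW L g = g ∧ ∫ y, (g : ℝ → ℝ) y = 0 := by
  rw [WevenZ, Submodule.mem_inf, LinearMap.mem_ker, LinearMap.mem_ker, ContinuousLinearMap.coe_coe, ContinuousLinearMap.coe_coe,
    show (ContinuousLinearMap.id ℝ (W L) - reflW L) g = g - reflW L g from rfl, sub_eq_zero, massW_apply]
  exact ⟨fun ⟨h1, h2⟩ => ⟨h1.symm, h2⟩, fun ⟨h1, h2⟩ => ⟨h1.symm, h2⟩⟩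

/-- Membership in the even zero-mass class, a.e. form. [folklore] -/
theorem mem_WevenZ_iff_ae (hL : 0 < L) (g : W L) :
    g ∈ WevenZ hL ↔ ((fun y => (g : ℝ → ℝ) (-y)) =ᵐ[volume] fun y => (g : ℝ → ℝ) y) ∧ ∫ y, (g : ℝ → ℝ) y = 0 := by
  rw [mem_WevenZ_iff]
  refine and_congr ?_ Iff.rfl
  constructor
  · intro h
    have h1 := reflW_ae_volume L hL g
    have h2 : ((reflW L g : W L) : ℝ → ℝ) =ᵐ[volume] ((g : W L) : ℝ → ℝ) := by rw [h]
    filter_upwards [h1, h2] with y hy1 hy2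
    rw [← hy1, hy2]
  · intro h
    refine Lp.ext ?_
    filter_upwards [reflW_ae L g, ae_μw_of_ae_volume (L := L) h] with y hy1 hy
    rw [hy1, hy]

/-- The even zero-mass class is closed. [folklore] -/
theorem isClosed_WevenZ (hL : 0 < L) : IsClosed (WevenZ hL : Set (W L)) := by
  have h : (WevenZ hL : Set (W L)) =
      (LinearMap.ker ((ContinuousLinearMap.id ℝ (W L) - reflW L : W L →L[ℝ] W L) : W L →ₗ[ℝ] W L) : Set (W L)) ∩
        (LinearMap.ker ((massW hL : W L →L[ℝ] ℝ) : W L →ₗ[ℝ] ℝ) : Set (W L)) := by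
    rw [WevenZ, Submodule.coe_inf]
  rw [h]
  exact (ContinuousLinearMap.isClosed_ker _).inter (ContinuousLinearMap.isClosed_ker _)

/-! ### §2 The even zero-mass class of `L²_w(ℂ)` -/

/-- Real and imaginary parts of `c • G`. [folklore] -/
theorem reW_imW_smul (c : ℂ) (G : Wc L) :
    reW L (c • G) = c.re • reW L G - c.im • imW L G ∧ imW L (c • G) = c.re • imW L G + c.im • reW L G := by
  have hs := Lp.coeFn_smul c G
  constructor
  · refine Lp.ext ?_
    filter_upwards [reW_ae (c • G), hs, Lp.coeFn_sub (c.re • reW L G) (c.im • imW L G), Lp.coeFn_smul c.re (reW L G),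
      Lp.coeFn_smul c.im (imW L G), reW_ae G, imW_ae G] with y h1 h2 h3 h4 h5 h6 h7
    rw [h1, h2, h3, Pi.sub_apply, h4, h5]
    simp only [Pi.smul_apply, smul_eq_mul]
    rw [h6, h7, Complex.mul_re]
  · refine Lp.ext ?_
    filter_upwards [imW_ae (c • G), hs, Lp.coeFn_add (c.re • imW L G) (c.im • reW L G), Lp.coeFn_smul c.re (imW L G),
      Lp.coeFn_smul c.im (reW L G), reW_ae G, imW_ae G] with y h1 h2 h3 h4 h5 h6 h7
    rw [h1, h2, h3, Pi.add_apply, h4, h5]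
    simp only [Pi.smul_apply, smul_eq_mul]
    rw [h6, h7, Complex.mul_im]

/-- **The even zero-mass class of `L²_w(ℂ)`**: both real and imaginary parts in `WevenZ`; a closed `ℂ`-subspace. [folklore] -/
def WcevenZ (hL : 0 < L) : Submodule ℂ (Wc L) where
  carrier := {G | reW L G ∈ WevenZ hL ∧ imW L G ∈ WevenZ hL}
  add_mem' := by
    rintro G H ⟨h1, h2⟩ ⟨h3, h4⟩
    refine ⟨?_, ?_⟩
    · rw [map_add]; exact (WevenZ hL).add_mem h1 h3
    · rw [map_add]; exact (WevenZ hL).add_mem h2 h4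
  zero_mem' := by
    refine ⟨?_, ?_⟩
    · rw [map_zero]; exact (WevenZ hL).zero_mem
    · rw [map_zero]; exact (WevenZ hL).zero_mem
  smul_mem' := by
    rintro c G ⟨h1, h2⟩
    obtain ⟨e1, e2⟩ := reW_imW_smul (L := L) c G
    refine ⟨?_, ?_⟩
    · show reW L (c • G) ∈ WevenZ hL
      rw [e1]; exact (WevenZ hL).sub_mem ((WevenZ hL).smul_mem _ h1) ((WevenZ hL).smul_mem _ h2)
    · show imW L (c • G) ∈ WevenZ hL
      rw [e2]; exact (WevenZ hL).add_mem ((WevenZ hL).smul_mem _ h2) ((WevenZ hL).smul_mem _ h1)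

/-- Membership in the complex even zero-mass class. [folklore] -/
theorem mem_WcevenZ_iff (hL : 0 < L) (G : Wc L) : G ∈ WcevenZ hL ↔ reW L G ∈ WevenZ hL ∧ imW L G ∈ WevenZ hL := Iff.rfl

/-- The complex even zero-mass class is closed. [folklore] -/
theorem isClosed_WcevenZ (hL : 0 < L) : IsClosed (WcevenZ hL : Set (Wc L)) := by
  have h : (WcevenZ hL : Set (Wc L)) = (reW L) ⁻¹' (WevenZ hL : Set (W L)) ∩ (imW L) ⁻¹' (WevenZ hL : Set (W L)) := by
    ext G; rfl
  rw [h]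
  exact ((isClosed_WevenZ hL).preimage (reW L).continuous).inter ((isClosed_WevenZ hL).preimage (imW L).continuous)

/-- The complex even zero-mass class is a Banach space. [folklore] -/
theorem completeSpace_WcevenZ (hL : 0 < L) : CompleteSpace (WcevenZ hL) :=
  (isClosed_WcevenZ hL).completeSpace_coe

/-- `ofPair (g_R, g_I) ∈ WcevenZ` when `g_R, g_I ∈ WevenZ`. [folklore] -/
theorem ofPair_mem_WcevenZ (hL : 0 < L) {P : WithLp 2 (W L × W L)} (h1 : P.fst ∈ WevenZ hL) (h2 : P.snd ∈ WevenZ hL) :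
    ofPair L P ∈ WcevenZ hL := by
  rw [mem_WcevenZ_iff, ← (toPair_fst_snd (ofPair L P)).1, ← (toPair_fst_snd (ofPair L P)).2, toPair_ofPair]
  exact ⟨h1, h2⟩

/-- `toPair` of an even zero-mass complex class has even zero-mass components. [folklore] -/
theorem toPair_mem_WevenZ (hL : 0 < L) {G : Wc L} (hG : G ∈ WcevenZ hL) :
    (toPair L G).fst ∈ WevenZ hL ∧ (toPair L G).snd ∈ WevenZ hL := by
  rw [(toPair_fst_snd G).1, (toPair_fst_snd G).2]; exact (mem_WcevenZ_iff hL G).1 hG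

/-! ### §3 Even energy-space profiles are even with zero mass -/

/-- **`ιEE p ∈ WevenZ`** for every `p ∈ EspE L`. [folklore] -/
theorem ιEE_mem_WevenZ (hL : 0 < L) (p : EspE L hL) : ιEE hL p ∈ WevenZ hL := by
  rw [mem_WevenZ_iff_ae]
  obtain ⟨-, heven, -, -, -, -, -, hmass⟩ := energyClassE_of_mem hL p
  have h1 := ιEE_ae hL p
  have h2 := (Measure.measurePreserving_neg (volume : Measure ℝ)).quasiMeasurePreserving.ae_eq_comp h1
  refine ⟨?_, ?_⟩
  · filter_upwards [h1, h2] with y hy1 hy2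
    rw [Function.comp_apply, Function.comp_apply] at hy2
    rw [hy2, hy1]
    exact heven y
  · rw [integral_congr_ae h1]; exact hmass

/-- `ofPair (ιpairE P) ∈ WcevenZ` for every even energy-space pair `P`. [folklore] -/
theorem ofPair_ιpairE_mem_WcevenZ (hL : 0 < L) (P : WithLp 2 (EspE L hL × EspE L hL)) : ofPair L (ιpairE hL P) ∈ WcevenZ hL := by
  obtain ⟨h1, h2⟩ := ιpairE_fst_snd hL P
  exact ofPair_mem_WcevenZ hL (by rw [h1]; exact ιEE_mem_WevenZ hL P.fst) (by rw [h2]; exact ιEE_mem_WevenZ hL P.snd)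

/-! ### §4 The density lemma: an even zero-mass class orthogonal to all zero-mass even tests vanishes -/

/-- The even part of a `C¹` compactly supported function, with its derivative, is an even test. [folklore] -/
theorem isCompactTestE_evenPart {ψ : ℝ → ℝ} (hψ : ContDiff ℝ 1 ψ) (hsupp : HasCompactSupport ψ) :
    IsCompactTestE (fun x => (ψ x + ψ (-x)) / 2) (deriv fun x => (ψ x + ψ (-x)) / 2) := by
  set φ : ℝ → ℝ := fun x => (ψ x + ψ (-x)) / 2 with hφ
  have hφC : ContDiff ℝ 1 φ := (hψ.add (hψ.comp contDiff_neg)).div_const 2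
  have hφd : ∀ x, HasDerivAt φ (deriv φ x) x := fun x => (hφC.differentiable one_ne_zero x).hasDerivAt
  have hcont : Continuous (deriv φ) := hφC.continuous_deriv le_rfl
  obtain ⟨R, hR⟩ := (hsupp.isCompact).isBounded.subset_closedBall 0
  have hzero : ∀ x, R < |x| → ψ x = 0 := fun x hx =>
    image_eq_zero_of_notMem_tsupport fun hmem => by
      have := hR hmem
      rw [Metric.mem_closedBall, dist_zero_right, Real.norm_eq_abs] at this
      linarith
  have hφzero : ∀ x, R < |x| → φ x = 0 := fun x hx => by
    have h1 := hzero x hx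
    have h2 := hzero (-x) (by rwa [abs_neg])
    simp only [hφ, h1, h2, add_zero, zero_div]
  have hφderiv_zero : ∀ x, R + 1 ≤ |x| → deriv φ x = 0 := by
    intro x hx
    have hev : φ =ᶠ[𝓝 x] fun _ => (0:ℝ) := by
      have : ∀ᶠ y in 𝓝 x, R < |y| := continuous_abs.continuousAt.eventually (lt_mem_nhds (by linarith))
      exact this.mono fun y hy => hφzero y hy
    rw [hev.deriv_eq, deriv_const]
  have hφsupp : HasCompactSupport (deriv φ) := by
    refine HasCompactSupport.intro (isCompact_closedBall (0:ℝ) (R + 1)) fun x hx => hφderiv_zero x ?_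
    rw [Metric.mem_closedBall, dist_zero_right, Real.norm_eq_abs, not_le] at hx
    exact hx.le
  refine ⟨⟨fun x => ?_, hcont.memLp_of_hasCompactSupport hφsupp,
    ⟨R + 1, fun x hx => ⟨hφzero x (by linarith), hφderiv_zero x hx⟩⟩⟩, fun y => ?_⟩
  · rw [intervalIntegral.integral_eq_sub_of_hasDerivAt (fun y _ => hφd y) (hcont.intervalIntegrable _ _)]
    ring
  · simp only [hφ, neg_neg]; ring

/-- **Extension by the defect device**: if `∫ w g v = 0` for every ZERO-MASS even test, then `∫ w g φ = (∫ w g ρ)·∫φ` for EVERY even test.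
[folklore] -/
theorem integral_weight_mul_testE (hL : 0 < L) (g : W L)
    (h : ∀ v v₁ : ℝ → ℝ, IsCompactTestE v v₁ → ∫ y, v y = 0 → ∫ y, (L ^ 2 + y ^ 2) * ((g : ℝ → ℝ) y * v y) = 0)
    {φ φ₁ : ℝ → ℝ} (hφ : IsCompactTestE φ φ₁) :
    ∫ y, (L ^ 2 + y ^ 2) * ((g : ℝ → ℝ) y * φ y) = (∫ y, (L ^ 2 + y ^ 2) * ((g : ℝ → ℝ) y * bumpFun y)) * ∫ y, φ y := by
  -- the pairing as a linear functional on the even tests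
  set Λ : testSpaceE →ₗ[ℝ] ℝ :=
    { toFun := fun vp => ∫ y, (L ^ 2 + y ^ 2) * ((g : ℝ → ℝ) y * vp.1.1 y)
      map_add' := by
        intro vp vq
        rw [← integral_add (integrable_weight_mul_any hL g vp.2.toIsCompactTestAny).1
          (integrable_weight_mul_any hL g vq.2.toIsCompactTestAny).1]
        refine integral_congr_ae (Eventually.of_forall fun y => ?_)
        show (L ^ 2 + y ^ 2) * ((g : ℝ → ℝ) y * (vp.1.1 y + vq.1.1 y)) = _
        ring
      map_smul' := by
        intro a vp
        rw [RingHom.id_apply, smul_eq_mul, ← integral_const_mul]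
        refine integral_congr_ae (Eventually.of_forall fun y => ?_)
        show (L ^ 2 + y ^ 2) * ((g : ℝ → ℝ) y * (a * vp.1.1 y)) = _
        ring } with hΛ
  have hvan : ∀ vp : testSpaceE, ∫ y, vp.1.1 y = 0 → Λ vp = 0 := fun vp h0 => h vp.1.1 vp.1.2 vp.2 h0
  have := eq_mass_mul_of_vanishes Λ hvan ⟨(φ, φ₁), hφ⟩
  rw [mul_comm] at this
  exact this

/-- **The density lemma.**  If `g ∈ WevenZ` and `∫ w g v = 0` for every ZERO-MASS even test `(v, v₁)`, then `g = 0`. [folklore] -/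
theorem eq_zero_of_mem_WevenZ (hL : 0 < L) {g : W L} (hg : g ∈ WevenZ hL)
    (h : ∀ v v₁ : ℝ → ℝ, IsCompactTestE v v₁ → ∫ y, v y = 0 → ∫ y, (L ^ 2 + y ^ 2) * ((g : ℝ → ℝ) y * v y) = 0) : g = 0 := by
  rw [mem_WevenZ_iff_ae] at hg
  obtain ⟨heven, hmass⟩ := hg
  set C : ℝ := ∫ y, (L ^ 2 + y ^ 2) * ((g : ℝ → ℝ) y * bumpFun y) with hC
  have hext := fun {φ φ₁ : ℝ → ℝ} (hφ : IsCompactTestE φ φ₁) => integral_weight_mul_testE hL g h hφ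
  have hloc := locallyIntegrable_weight_mul hL g
  have hlocC : LocallyIntegrable (fun y => (L ^ 2 + y ^ 2) * (g : ℝ → ℝ) y - C) volume := hloc.sub (locallyIntegrable_const C)
  -- `w g − C` annihilates every smooth bump
  have hae : ∀ᵐ y ∂volume, (L ^ 2 + y ^ 2) * (g : ℝ → ℝ) y - C = 0 := by
    refine ae_eq_zero_of_integral_contDiff_smul_eq_zero hlocC fun ψ hψ hsupp => ?_
    have hψ1 : ContDiff ℝ 1 ψ := hψ.of_le (by exact_mod_cast le_top)
    have htest := isCompactTestE_evenPart hψ1 hsupp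
    have hevenpart := hext htest
    have hψc : Continuous ψ := hψ.continuous
    have hψn : Continuous fun x => ψ (-x) := hψc.comp continuous_neg
    have hsuppn : HasCompactSupport fun x => ψ (-x) := hsupp.comp_homeomorph (Homeomorph.neg ℝ)
    have hψi : Integrable ψ := hψc.integrable_of_hasCompactSupport hsupp
    have hψni : Integrable fun x => ψ (-x) := hψn.integrable_of_hasCompactSupport hsuppn
    have hI1 : Integrable (fun y => ψ y • ((L ^ 2 + y ^ 2) * (g : ℝ → ℝ) y)) := hloc.integrable_smul_left_of_hasCompactSupport hψc hsupp
    have hI2 : Integrable (fun y => ψ (-y) • ((L ^ 2 + y ^ 2) * (g : ℝ → ℝ) y)) :=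
      hloc.integrable_smul_left_of_hasCompactSupport hψn hsuppn
    have hIo : Integrable (fun y => ((ψ y - ψ (-y)) / 2) * ((L ^ 2 + y ^ 2) * (g : ℝ → ℝ) y)) :=
      ((hI1.sub hI2).div_const 2).congr (Eventually.of_forall fun y => by simp only [smul_eq_mul, Pi.sub_apply]; ring)
    have hIe : Integrable (fun y => ((ψ y + ψ (-y)) / 2) * ((L ^ 2 + y ^ 2) * (g : ℝ → ℝ) y)) :=
      ((hI1.add hI2).div_const 2).congr (Eventually.of_forall fun y => by simp only [smul_eq_mul, Pi.add_apply]; ring)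
    have hIC : Integrable (fun y => ψ y * C) := hψi.mul_const C
    have hsplit : (fun y => ψ y • ((L ^ 2 + y ^ 2) * (g : ℝ → ℝ) y - C)) = fun y =>
        ((ψ y - ψ (-y)) / 2) * ((L ^ 2 + y ^ 2) * (g : ℝ → ℝ) y) + ((ψ y + ψ (-y)) / 2) * ((L ^ 2 + y ^ 2) * (g : ℝ → ℝ) y)
          - ψ y * C := by
      funext y; simp only [smul_eq_mul]; ring
    have hIoe : Integrable (fun y => ((ψ y - ψ (-y)) / 2) * ((L ^ 2 + y ^ 2) * (g : ℝ → ℝ) y)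
        + ((ψ y + ψ (-y)) / 2) * ((L ^ 2 + y ^ 2) * (g : ℝ → ℝ) y)) := hIo.add hIe
    rw [hsplit, integral_sub hIoe hIC, integral_add hIo hIe]
    -- odd part: integrand odd (`w g` is a.e. even)
    have h1 : ∫ y, ((ψ y - ψ (-y)) / 2) * ((L ^ 2 + y ^ 2) * (g : ℝ → ℝ) y) = 0 := by
      refine integral_eq_zero_of_ae_odd ?_
      filter_upwards [heven] with y hy
      simp only [neg_neg, neg_sq, hy]
      ring
    -- even part: an even test, so the pairing is `C · ∫(even part)`
    have h2 : ∫ y, ((ψ y + ψ (-y)) / 2) * ((L ^ 2 + y ^ 2) * (g : ℝ → ℝ) y) = C * ∫ y, (ψ y + ψ (-y)) / 2 := by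
      rw [← hevenpart]
      refine integral_congr_ae (Eventually.of_forall fun y => ?_)
      ring
    -- `∫ ψ = ∫ (even part)` (the odd part has integral zero)
    have h3 : ∫ y, ψ y * C = C * ∫ y, (ψ y + ψ (-y)) / 2 := by
      rw [integral_mul_const, mul_comm]
      congr 1
      have hn : ∫ y, ψ (-y) = ∫ y, ψ y := integral_neg_eq_self ψ volume
      rw [integral_div, integral_add hψi hψni, hn]
      ring
    rw [h1, h2, h3]; ring
  -- hence `g = C·w⁻¹` a.e.; zero mass forces `C = 0`
  have hgC : (g : ℝ → ℝ) =ᵐ[volume] fun y => C * (L ^ 2 + y ^ 2)⁻¹ := by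
    filter_upwards [hae] with y hy
    have hw : 0 < L ^ 2 + y ^ 2 := by positivity
    field_simp
    linarith
  have hint : ∫ y, (g : ℝ → ℝ) y = C * (π / L) := by
    rw [integral_congr_ae hgC, integral_const_mul, Literature.NumberTheory.LFunctions.ZeroDensity.integral_inv_sq_add_sq_real hL]
  have hC0 : C = 0 := by
    rw [hmass] at hint
    have hπ : 0 < π / L := div_pos Real.pi_pos hL
    rcases mul_eq_zero.1 hint.symm with h0 | h0
    · exact h0
    · exact absurd h0 hπ.ne'
  have hg0 : (g : ℝ → ℝ) =ᵐ[volume] 0 := by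
    filter_upwards [hgC] with y hy
    rw [hy, hC0, zero_mul, Pi.zero_apply]
  exact (Lp.eq_zero_iff_ae_eq_zero).2 (ae_μw_of_ae_volume hg0)

/-- **The density lemma, complex form.**  If `G ∈ WcevenZ` and both `Re G` and `Im G` pair to zero against every zero-mass even test, then
`G = 0`. [folklore] -/
theorem eq_zero_of_mem_WcevenZ (hL : 0 < L) {G : Wc L} (hG : G ∈ WcevenZ hL)
    (hre : ∀ v v₁ : ℝ → ℝ, IsCompactTestE v v₁ → ∫ y, v y = 0 → ∫ y, (L ^ 2 + y ^ 2) * (((reW L G : W L) : ℝ → ℝ) y * v y) = 0)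
    (him : ∀ v v₁ : ℝ → ℝ, IsCompactTestE v v₁ → ∫ y, v y = 0 → ∫ y, (L ^ 2 + y ^ 2) * (((imW L G : W L) : ℝ → ℝ) y * v y) = 0) :
    G = 0 := by
  obtain ⟨h1, h2⟩ := (mem_WcevenZ_iff hL G).1 hG
  have e1 := eq_zero_of_mem_WevenZ hL h1 hre
  have e2 := eq_zero_of_mem_WevenZ hL h2 him
  rw [← ofPair_toPair G]
  have h1' : (toPair L G).fst = (0 : WithLp 2 (W L × W L)).fst := by rw [(toPair_fst_snd G).1, e1, WithLp.zero_fst]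
  have h2' : (toPair L G).snd = (0 : WithLp 2 (W L × W L)).snd := by rw [(toPair_fst_snd G).2, e2, WithLp.zero_snd]
  have : toPair L G = 0 := WithLp.ofLp_injective 2 (Prod.ext h1' h2')
  rw [this, map_zero]

end SheetREvenClass
end Summit.NavierStokesRegularity.OSWSelfSimilar

end
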